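import Summits.ValiantsHypothesis.ValiantsHypothesis.Theorems.LacunarySymmetroidMatrixDescartesCensusV19SCheck
import Summits.ValiantsHypothesis.ValiantsHypothesis.Theorems.LacunarySymmetroidMatrixDescartesCensusV20Model

/-!
# `MatrixDescartes` census — semantics of the 2-SIDON `V = 19` certificate checker (Cases A and B; definitions)

HONEST FRAMING.  Object-search cell `pub-symmetroid`; door-A item `DoorA26 = PosRootLawAt 2 6 19`
(stmt-ValiantsHypothesis-19979; OPEN, typed, never asserted) and its sharper support rows `PosRootLawOn 2 6 18 d`.  DEFINITIONS ONLY: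
the real-valued semantics of the checker `…CensusV19SCheck` — the real sign of a position in a cell (`0` at the zero position of mode
`B z`, else `∓1` by `V19S.negSlot`), well-formedness of a cell context, the window terms `x_t · P_t · y^{E_t}` (REDUCED weights) of the
three windows through a repetition, and the `Model` of a cell: everything a hypothetical pencil with `19` distinct positive det-roots on a
2-Sidon support supplies in the cell `(s, mode)` it realises and in the branch `mid` it falls in — positive position magnitudes, the signed
atom valuation, the Newton-cone rows (mode A: alternating triples, `Census.newton_window_of_alternating`; mode B: consecutive live triples,
`Census.newton_cone_coeff`), the three window balances (`Census.flank_balance_low_support` / `…high_support` / `window_balance_mid_support`)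
with the branch inequality of the middle window, the Gram inequalities `G3, RCS, W ≥ 0`, no odd definite triangle, no odd triangle through a
null letter.  Values of terms / polynomials / rows (`tval`, `pval`, `lprod`, `Row.Holds`, `Row.WF` over the `21` positions) and the entry-level
atoms `aval`, `pdet` are those of `…CensusV20Model`.  The proofs (`…CensusV19SSound*`) show that a model refutes every accepted certificate and
that a nineteen (given the `V = 20` row of its support) yields a model.  Nothing here bears on the one-collision supports, on `ζ_sym(2,6)` over
all supports, on `MatrixDescartes` (stmt-ValiantsHypothesis-18050) or on `VP ≠ VNP`.

[folklore] Bookkeeping; elementary.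
-/

-- the D-0017 layout repeats a namespace component (single-conjunct summit); the `dupNamespace` linter flags it; name mandated.
set_option linter.dupNamespace false

namespace Summit.ValiantsHypothesis.ValiantsHypothesis.Theorems.LacunarySymmetroidMatrixDescartes.Census.V19S

open V20 (Atom allAtoms psum posOf ordOK sums qA cA Term PolySpec posl FNat fval Row rowC25 rowOne rowAmgm FRat negAt
  G3poly RCSpoly Wpoly tval pval lprod)

/-! ## Signs and well-formedness -/

/-- Real sign attached to a position of a cell: `0` at the zero position (mode `B`), `−1` at a negative position, `1` otherwise. [folklore] -/
noncomputable def sgR (c : Ctx) (p : ℕ) : ℝ :=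
  if zeroSlot c.mode p then 0 else if negSlot c.s c.mode p then -1 else 1

/-- What the soundness layer needs of a cell context: the order passed `V20.ordOK`, `E` is the list of the `21` sums, the mode is
well formed (`A k` with `k < 20`, `B z` with `z ≤ 20`). [folklore] -/
structure Ctx.WF (c : Ctx) : Prop where
  /-- the order is the verified 2-Sidon order -/
  hord : ordOK c.d c.ord = true
  /-- the sums are those of the order -/
  hE : c.E = sums c.d c.ord
  /-- the mode is well formed -/
  hmode : c.mode.ok = true

/-! ## Window terms -/

/-- The REDUCED weight `P_t = ∏_{u ∈ E, u ∉ window} |E_t − u|` of position `t` for the window starting at position `w₀`, as a real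
(the value of the checker's factored natural `redW … 1`). [folklore] -/
noncomputable def redWR (c : Ctx) (w0 t : ℕ) : ℝ := (fval (redW c.E (winSums c.E w0) (c.E.getD t 0) 1) : ℝ)

/-- The window term of position `t` at the point `y`: `x_t · P_t · y^{E_t}` (window starting at `w₀`). [folklore] -/
noncomputable def wterm (c : Ctx) (x : ℕ → ℝ) (w0 t : ℕ) (y : ℝ) : ℝ := x t * redWR c w0 t * y ^ (c.E.getD t 0)

/-! ## The model of a cell -/

/-- What a hypothetical pencil with `19` distinct positive det-roots on a 2-Sidon support (whose coefficients do not all alternate)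
supplies in the cell `c = (s, mode)` it realises and the branch `c.mid` it falls in: positive position magnitudes `x`, the signed atom
valuation `v` (zero position `↦ 0`), the Newton-cone rows of the mode, the window balances of mode `A` (with the branch inequality of the
middle window), the Gram inequalities, and the two triangle facts. [folklore] -/
structure Model (c : Ctx) (x : ℕ → ℝ) (v : Atom → ℝ) : Prop where
  /-- the context is well formed -/
  wf : c.WF
  /-- position magnitudes are positive -/
  xpos : ∀ t, 0 < x t
  /-- atoms evaluate to signed position magnitudes -/
  hv : ∀ a ∈ allAtoms, v a = sgR c (c.slot a) * x (c.slot a)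
  /-- mode A: Newton-cone rows through positions `t − 1, t, t + 1` away from the repetition -/
  c25A : ∀ k t, c.mode = .A k → 1 ≤ t → t ≤ 19 → t ≠ k → t ≠ k + 1 → (rowC25 c.E t).Holds x
  /-- mode B: Newton-cone rows through the live sums of live index `t − 1, t, t + 1` -/
  c25B : ∀ z t, c.mode = .B z → 1 ≤ t → t ≤ 18 → (rowC25B c.E z t).Holds x
  /-- mode A, LEFT window `(k−2, k−1, k, k+1)`: the isolated term balances the other three -/
  winLow : ∀ k, c.mode = .A k → 2 ≤ k → ∃ y : ℝ, 0 < y ∧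
    wterm c x (k - 2) (k - 1) y = wterm c x (k - 2) (k - 2) y + wterm c x (k - 2) k y + wterm c x (k - 2) (k + 1) y
  /-- mode A, RIGHT window `(k, k+1, k+2, k+3)`: the isolated term balances the other three -/
  winHigh : ∀ k, c.mode = .A k → k + 3 ≤ 20 → ∃ y : ℝ, 0 < y ∧
    wterm c x k (k + 2) y = wterm c x k k y + wterm c x k (k + 1) y + wterm c x k (k + 3) y
  /-- mode A, MIDDLE window `(k−1, k, k+1, k+2)`: outer sum = middle sum, and the branch names a maximal middle term -/
  winMid : ∀ k, c.mode = .A k → 1 ≤ k → k + 2 ≤ 20 → ∃ y : ℝ, 0 < y ∧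
    wterm c x (k - 1) (k - 1) y + wterm c x (k - 1) (k + 2) y = wterm c x (k - 1) k y + wterm c x (k - 1) (k + 1) y ∧
    (c.mid = some k → wterm c x (k - 1) (k + 1) y ≤ wterm c x (k - 1) k y) ∧
    (c.mid = some (k + 1) → wterm c x (k - 1) k y ≤ wterm c x (k - 1) (k + 1) y)
  /-- `G3 ≥ 0` -/
  g3 : ∀ i j k, i < j → j < k → k < 6 → 0 ≤ pval v (G3poly i j k)
  /-- `RCS ≥ 0` for a definite first letter -/
  rcs : ∀ i j, i < 6 → j < 6 → i ≠ j → 0 < v (qA i) → 0 ≤ pval v (RCSpoly i j)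
  /-- `W ≥ 0` -/
  w : ∀ i j k l, i < 6 → j < 6 → k < 6 → l < 6 → i ≠ j → i ≠ k → i ≠ l → j ≠ k → j ≠ l → k < l →
    0 ≤ pval v (Wpoly i j k l)
  /-- no odd definite triangle -/
  tri : ∀ i j k, i < j → j < k → k < 6 → 0 < v (qA i) → 0 < v (qA j) → 0 < v (qA k) →
    0 < v (cA i j) * v (cA j k) * v (cA i k)
  /-- no odd triangle through a null letter `n` and definite letters `a, b` (edge `β(n,b) ≠ 0`) -/
  triNull : ∀ n a b, n < 6 → a < b → b < 6 → n ≠ a → n ≠ b → v (qA n) = 0 → 0 < v (qA a) → 0 < v (qA b) →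
    v (cA n b) ≠ 0 → 0 < v (cA n a) * v (cA a b) * v (cA n b)

end Summit.ValiantsHypothesis.ValiantsHypothesis.Theorems.LacunarySymmetroidMatrixDescartes.Census.V19S
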